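import Mathlib
import Literature.NumberTheory.Transcendental.GammaFields
import Literature.NumberTheory.Transcendental.GammaIsoAlgebraicStep
import Summits.Schanuel.Schanuel.Theorems.RigidCoreAclSubsetLogFreeCoreCaseI

/-!
# Case II reduction, file 1: `δ = 0` subspaces of E/L/A-chain spaces
(helper file for the registered stub `stub_caseII_reduce` of line `eac-extends-core-automorphisms`,
crux stmt-Schanuel-0968 `Summit.Schanuel.Schanuel.Theses.RigidCore.AclSubsetLogFreeCore`)

Setting: an exponential field `F` of characteristic `0` and the Bays–Kirby Γ-field calculus of
`Literature/NumberTheory/Transcendental/GammaFields.lean` (`acl`, `gens`, `predim`, `IsStrong`, …).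
An **E/L/A-chain** over a subspace `Λ` is a finite tuple `u` each of whose entries `u i` is an
A-step (`u i` algebraic over the Γ-field `ℚ(gens P)` of the space `P = Λ + ℚ(u '' Iio i)` reached so
far) or an L-step (`exp (u i)` algebraic over it); repetitions are allowed (the condition is only on
membership in a relative algebraic closure), so chains concatenate. The chain SPACE is
`Λ + ℚ(range u)`.

* `predim_inf_eq_zero` — over a strong `Λ`, finitely generated extensions of predimension `0` are
  closed under `⊓` (submodularity, Bays–Kirby Lemma 4.2 (3), and Lemma 4.8).
* `chainPrefix_isStrong_and_predim_eq_zero` — every prefix space of a chain over a strong `Λ` is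
  strong of predimension `0` (iterated Lemma 4.8).
* `mem_acl_of_td_le_one`, `exp_mem_acl_of_td_le_one` — matroid bookkeeping: `td(h, exp h/P) ≤ 1`
  and `exp h` transcendental over `ℚ(gens P)(h)` force `h` algebraic over `ℚ(gens P)` (and dually).
* `le_of_closed_of_le_chainSpace` — the **echelon lemma** in closure form: if `H` is a `δ = 0`
  subspace (over `Λ`) of a chain space and `Λ ≤ U ≤ H` is closed inside `H` under A- and L-steps,
  then `U = H`. In particular a `δ = 0` subspace of a chain space is exhausted by A/L-steps from `Λ`.
* `exists_Lstep_of_Aclosed` — consequently, a proper A-closed subspace `X` of such an `H` admits an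
  L-step inside `H`.
-/

noncomputable section

set_option linter.dupNamespace false

open Set
open Literature.ModelTheory.ExponentialFields Literature.ModelTheory.ExponentialFields.ExponentialRing
open Literature.NumberTheory.Transcendental Literature.NumberTheory.Transcendental.GammaField

namespace Summit.Schanuel.Schanuel.Theorems.RigidCore

namespace CaseIIReduce

variable {F : Type} [Field F] [CharZero F] [ExponentialRing F]

/-! ### `δ = 0` extensions of a strong base are closed under intersection -/

/-- **`δ = 0` subspaces over a strong base are closed under `⊓`.** If `Λ ◁ F` and `A, B ⊇ Λ` are
finitely generated over `Λ` with `δ(A/Λ) = δ(B/Λ) = 0`, then `δ(A ∩ B/Λ) = 0`: it is `≥ 0` because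
`Λ` is strong, and `δ(A ∩ B/Λ) = -δ(A/A ∩ B) ≤ -δ(A + B/B) ≤ 0` by submodularity and strongness of `B`
(Lemma 4.8). [cite: BaysKirby2018ANT, Lemma 4.2 (3), Lemma 4.8] -/
theorem predim_inf_eq_zero {Λ A B : Submodule ℚ F} (hΛ : IsStrong Λ) (hA : Λ ≤ A) (hB : Λ ≤ B)
    (hfgA : IsFG Λ A) (hfgB : IsFG Λ B) (hδA : predim Λ A = 0) (hδB : predim Λ B = 0) :
    predim Λ (A ⊓ B) = 0 := by
  have hle : Λ ≤ A ⊓ B := le_inf hA hB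
  have h0 : 0 ≤ predim Λ (A ⊓ B) := hΛ hle (hfgA.mono inf_le_left)
  have hadd := predim_add hle (inf_le_left : A ⊓ B ≤ A) hfgA
  have hfg' : IsFG (A ⊓ B) A := hfgA.of_le_left hle
  have hsub := predim_sup_le A B hfg'
  have hBs : IsStrong B := hΛ.of_predim_eq_zero hB hfgB hδB
  have hBpos : 0 ≤ predim B (A ⊔ B) :=
    hBs le_sup_right (isFG_sup_right.2 ((isFG_iff_isFG_inf A B).2 hfg'))
  linarith

/-! ### Prefix spaces of a tuple -/

omit [Field F] [CharZero F] [ExponentialRing F] in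
/-- The prefix with no element is empty. [folklore] -/
theorem image_lt_zero {n : ℕ} (u : Fin n → F) : (u '' {j : Fin n | (j : ℕ) < 0}) = ∅ := by
  simp

omit [Field F] [CharZero F] [ExponentialRing F] in
/-- The prefix of length `≥ n` is the whole range. [folklore] -/
theorem image_lt_of_le {n k : ℕ} (u : Fin n → F) (hk : n ≤ k) :
    (u '' {j : Fin n | (j : ℕ) < k}) = range u := by
  rw [← image_univ]; congr 1; ext j
  simp only [mem_setOf_eq, mem_univ, iff_true]
  exact lt_of_lt_of_le j.isLt hk

omit [Field F] [CharZero F] [ExponentialRing F] in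
/-- One more element in the prefix. [folklore] -/
theorem image_lt_succ {n k : ℕ} (u : Fin n → F) (hk : k < n) :
    (u '' {j : Fin n | (j : ℕ) < k + 1}) = insert (u ⟨k, hk⟩) (u '' {j : Fin n | (j : ℕ) < k}) := by
  rw [← image_insert_eq]; congr 1; ext j
  simp only [mem_setOf_eq, mem_insert_iff, Fin.ext_iff]
  omega

omit [Field F] [CharZero F] [ExponentialRing F] in
/-- The prefix `{j | j < i}` is `Iio i`. [folklore] -/
theorem image_lt_eq_image_Iio {n : ℕ} (u : Fin n → F) (i : Fin n) :
    (u '' {j : Fin n | (j : ℕ) < i}) = u '' Set.Iio i := rfl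

omit [ExponentialRing F] in
/-- The prefix spaces: one more generator. [folklore] -/
theorem prefix_succ_eq (Λ : Submodule ℚ F) {n k : ℕ} (u : Fin n → F) (hk : k < n) :
    Λ ⊔ Submodule.span ℚ (u '' {j : Fin n | (j : ℕ) < k + 1}) =
      (Λ ⊔ Submodule.span ℚ (u '' {j : Fin n | (j : ℕ) < k})) ⊔ Submodule.span ℚ {u ⟨k, hk⟩} := by
  rw [image_lt_succ u hk, Submodule.span_insert, sup_assoc, sup_comm (Submodule.span ℚ {u ⟨k, hk⟩})]

omit [ExponentialRing F] in
/-- The prefix spaces increase. [folklore] -/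
theorem prefix_mono (Λ : Submodule ℚ F) {n k l : ℕ} (u : Fin n → F) (hkl : k ≤ l) :
    Λ ⊔ Submodule.span ℚ (u '' {j : Fin n | (j : ℕ) < k}) ≤
      Λ ⊔ Submodule.span ℚ (u '' {j : Fin n | (j : ℕ) < l}) :=
  sup_le_sup_left (Submodule.span_mono (image_mono fun _ hj => lt_of_lt_of_le hj hkl)) _

omit [ExponentialRing F] in
/-- The prefix spaces are finitely generated over the base. [folklore] -/
theorem isFG_prefix (Λ : Submodule ℚ F) {n : ℕ} (u : Fin n → F) (s : Set (Fin n)) :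
    IsFG Λ (Λ ⊔ Submodule.span ℚ (u '' s)) :=
  isFG_sup_left.2 (isFG_span_of_finite Λ ((toFinite s).image u))

/-! ### Chains over a strong base: every prefix is strong of predimension `0` -/

/-- **Iterated Lemma 4.8 along an E/L/A-chain, all prefixes.** If `Λ ◁ F` and each `u i` is an
A-step or an L-step over the space `Λ + ℚ(u '' Iio i)` reached so far (membership in that space is
allowed), then every prefix space `Λ + ℚ(u₀, …, uₖ₋₁)` is strong with `δ = 0` over `Λ`.
[cite: BaysKirby2018ANT, Lemma 4.8] -/
theorem chainPrefix_isStrong_and_predim_eq_zero {Λ : Submodule ℚ F} (hΛ : IsStrong Λ)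
    {n : ℕ} (u : Fin n → F)
    (hu : ∀ i : Fin n, u i ∈ acl (gens (Λ ⊔ Submodule.span ℚ (u '' Set.Iio i))) ∨
      exp (u i) ∈ acl (gens (Λ ⊔ Submodule.span ℚ (u '' Set.Iio i)))) :
    ∀ k : ℕ, k ≤ n →
      IsStrong (Λ ⊔ Submodule.span ℚ (u '' {j : Fin n | (j : ℕ) < k})) ∧
        predim Λ (Λ ⊔ Submodule.span ℚ (u '' {j : Fin n | (j : ℕ) < k})) = 0 := by
  intro k hk
  induction k with
  | zero =>
    rw [image_lt_zero, Submodule.span_empty, sup_bot_eq]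
    exact ⟨hΛ, predim_self Λ⟩
  | succ k ih =>
    obtain ⟨hs, hδ⟩ := ih (Nat.le_of_succ_le hk)
    have hkn : k < n := hk
    set W : Submodule ℚ F := Λ ⊔ Submodule.span ℚ (u '' {j : Fin n | (j : ℕ) < k}) with hW
    rw [prefix_succ_eq Λ u hkn]
    have hAL : u ⟨k, hkn⟩ ∈ acl (gens W) ∨ exp (u ⟨k, hkn⟩) ∈ acl (gens W) := hu ⟨k, hkn⟩
    by_cases hmem : u ⟨k, hkn⟩ ∈ W
    · rw [sup_eq_left.2 ((Submodule.span_singleton_le_iff_mem _ _).2 hmem)]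
      exact ⟨hs, hδ⟩
    · have hδk : predim W (Submodule.span ℚ {u ⟨k, hkn⟩}) = 0 :=
        predim_span_singleton_eq_zero_of_acl hs hmem hAL
      have hfgk : IsFG W (W ⊔ Submodule.span ℚ {u ⟨k, hkn⟩}) :=
        isFG_sup_left.2 (isFG_span_of_finite W (finite_singleton _))
      have hs' : IsStrong (W ⊔ Submodule.span ℚ {u ⟨k, hkn⟩}) :=
        hs.of_predim_eq_zero le_sup_left hfgk (by rw [predim_sup_left]; exact hδk)
      refine ⟨hs', ?_⟩
      have hfgΛ : IsFG Λ (W ⊔ Submodule.span ℚ {u ⟨k, hkn⟩}) := by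
        rw [← prefix_succ_eq Λ u hkn]; exact isFG_prefix Λ u _
      rw [predim_add (le_sup_left : Λ ≤ W) le_sup_left hfgΛ, hδ, predim_sup_left, hδk, add_zero]

/-- **Chain spaces over a strong base are strong of predimension `0`.** [cite: BaysKirby2018ANT, Lemma 4.8] -/
theorem chain_isStrong_and_predim_eq_zero {Λ : Submodule ℚ F} (hΛ : IsStrong Λ)
    {n : ℕ} (u : Fin n → F)
    (hu : ∀ i : Fin n, u i ∈ acl (gens (Λ ⊔ Submodule.span ℚ (u '' Set.Iio i))) ∨
      exp (u i) ∈ acl (gens (Λ ⊔ Submodule.span ℚ (u '' Set.Iio i)))) :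
    IsStrong (Λ ⊔ Submodule.span ℚ (range u)) ∧ predim Λ (Λ ⊔ Submodule.span ℚ (range u)) = 0 := by
  have h := chainPrefix_isStrong_and_predim_eq_zero hΛ u hu n le_rfl
  rwa [image_lt_of_le u le_rfl] at h

/-- **Prefix spaces `Λ + ℚ(u '' Iio i)` of a chain over a strong base are strong of predimension
`0`.** [cite: BaysKirby2018ANT, Lemma 4.8] -/
theorem chainPrefix_isStrong_and_predim_eq_zero' {Λ : Submodule ℚ F} (hΛ : IsStrong Λ)
    {n : ℕ} (u : Fin n → F)
    (hu : ∀ i : Fin n, u i ∈ acl (gens (Λ ⊔ Submodule.span ℚ (u '' Set.Iio i))) ∨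
      exp (u i) ∈ acl (gens (Λ ⊔ Submodule.span ℚ (u '' Set.Iio i)))) (i : Fin n) :
    IsStrong (Λ ⊔ Submodule.span ℚ (u '' Set.Iio i)) ∧
      predim Λ (Λ ⊔ Submodule.span ℚ (u '' Set.Iio i)) = 0 := by
  have h := chainPrefix_isStrong_and_predim_eq_zero hΛ u hu i (le_of_lt i.isLt)
  rwa [image_lt_eq_image_Iio] at h

/-! ### Matroid bookkeeping: `td ≤ 1` and one transcendence force one algebraicity -/

/-- If `td(h, exp h/P) ≤ 1` and `exp h` is transcendental over `ℚ(gens P)(h)`, then `h` is algebraic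
over `ℚ(gens P)`. [folklore] -/
theorem mem_acl_of_td_le_one {Λ : Submodule ℚ F} {h : F}
    (htd : td Λ (Submodule.span ℚ {h}) ≤ 1) (hexp : exp h ∉ acl (insert h (gens Λ))) :
    h ∈ acl (gens Λ) := by
  by_contra hh
  rw [td_span_singleton, pair_comm] at htd
  have h1 : (algMatroid F).relRank (gens Λ) {h} ≠ 0 := by
    rw [Ne, Matroid.relRank_eq_zero_iff]
    intro hsub
    exact hh (hsub ⟨mem_singleton h, mem_univ h⟩)
  have h2 : (algMatroid F).relRank (gens Λ) {exp h, h} = (algMatroid F).relRank (gens Λ) {h} + 1 :=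
    (algMatroid F).relRank_insert_eq_add_one (mem_univ _) (by rwa [singleton_union])
  rw [h2] at htd
  have h3 : (1 : ℕ∞) ≤ (algMatroid F).relRank (gens Λ) {h} := Order.one_le_iff_ne_zero.2 h1
  have h4 : (2 : ℕ∞) ≤ 1 := le_trans (by
    calc (2 : ℕ∞) = 1 + 1 := by norm_num
      _ ≤ (algMatroid F).relRank (gens Λ) {h} + 1 := add_le_add h3 le_rfl) htd
  exact absurd h4 (by decide)

/-- If `td(h, exp h/P) ≤ 1` and `h` is transcendental over `ℚ(gens P)(exp h)`, then `exp h` is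
algebraic over `ℚ(gens P)`. [folklore] -/
theorem exp_mem_acl_of_td_le_one {Λ : Submodule ℚ F} {h : F}
    (htd : td Λ (Submodule.span ℚ {h}) ≤ 1) (hnot : h ∉ acl (insert (exp h) (gens Λ))) :
    exp h ∈ acl (gens Λ) := by
  by_contra hh
  rw [td_span_singleton] at htd
  have h1 : (algMatroid F).relRank (gens Λ) {exp h} ≠ 0 := by
    rw [Ne, Matroid.relRank_eq_zero_iff]
    intro hsub
    exact hh (hsub ⟨mem_singleton (exp h), mem_univ _⟩)
  have h2 : (algMatroid F).relRank (gens Λ) {h, exp h} =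
      (algMatroid F).relRank (gens Λ) {exp h} + 1 :=
    (algMatroid F).relRank_insert_eq_add_one (mem_univ _) (by rwa [singleton_union])
  rw [h2] at htd
  have h3 : (1 : ℕ∞) ≤ (algMatroid F).relRank (gens Λ) {exp h} := Order.one_le_iff_ne_zero.2 h1
  have h4 : (2 : ℕ∞) ≤ 1 := le_trans (by
    calc (2 : ℕ∞) = 1 + 1 := by norm_num
      _ ≤ (algMatroid F).relRank (gens Λ) {exp h} + 1 := add_le_add h3 le_rfl) htd
  exact absurd h4 (by decide)

/-- Over a strong `P`, an element `h ∉ P` with `δ(h/P) = 0` has `td(h, exp h/P) ≤ 1`. [folklore] -/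
theorem td_le_one_of_predim_eq_zero {Λ : Submodule ℚ F} {h : F} (hh : h ∉ Λ)
    (hδ : predim Λ (Submodule.span ℚ {h}) = 0) : td Λ (Submodule.span ℚ {h}) ≤ 1 := by
  have hne : td Λ (Submodule.span ℚ {h}) ≠ ⊤ :=
    td_ne_top (isFG_span_of_finite Λ (finite_singleton h))
  have h1 : (td Λ (Submodule.span ℚ {h})).toNat = 1 := by
    rw [predim_def, ldim_span_singleton_of_not_mem hh] at hδ; omega
  rw [← ENat.coe_toNat hne, h1, Nat.cast_one]

/-! ### The echelon lemma: `δ = 0` subspaces of chain spaces are exhausted by A/L-steps -/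

/-- **Echelon lemma (closure form).** Let `Λ ◁ F`, `u` an E/L/A-chain over `Λ` with chain space
`W = Λ + ℚ(range u)`, `Λ ≤ H ≤ W` with `δ(H/Λ) = 0`, and `U ⊇ Λ` closed inside `H` under A- and
L-steps (`h ∈ H`, `h` or `exp h` algebraic over `ℚ(gens U)` `⟹ h ∈ U`). Then `H ≤ U`. Proof:
`H ∩ Wₖ ≤ U` by induction on the prefix `Wₖ`: `V = H ∩ Wₖ₊₁ ⊇ V₀ = H ∩ Wₖ` are `δ = 0` over `Λ`
(`predim_inf_eq_zero`) with `dim V/V₀ ≤ 1`, so an `h ∈ V ∖ Wₖ` has `δ(h/V₀) = 0`; writing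
`h = w + q uₖ`, the step type of `uₖ` over the strong `Wₖ` and `GammaField.exp_not_mem_acl_of_mem_acl`
/ `not_mem_acl_of_exp_mem_acl` leave only "`h` algebraic over `ℚ(gens V₀)`" (A) resp. "`exp h`
algebraic over `ℚ(gens V₀)`" (L), and `V₀ ≤ U` is closed. [cite: BaysKirby2018ANT, Lemma 4.8, §4.4] -/
theorem le_of_closed_of_le_chainSpace {Λ H U : Submodule ℚ F} (hΛ : IsStrong Λ) {n : ℕ}
    (u : Fin n → F)
    (hu : ∀ i : Fin n, u i ∈ acl (gens (Λ ⊔ Submodule.span ℚ (u '' Set.Iio i))) ∨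
      exp (u i) ∈ acl (gens (Λ ⊔ Submodule.span ℚ (u '' Set.Iio i))))
    (hΛH : Λ ≤ H) (hHW : H ≤ Λ ⊔ Submodule.span ℚ (range u)) (hδH : predim Λ H = 0)
    (hΛU : Λ ≤ U)
    (hclosed : ∀ h ∈ H, (h ∈ acl (gens U) ∨ exp h ∈ acl (gens U)) → h ∈ U) : H ≤ U := by
  classical
  set W : ℕ → Submodule ℚ F := fun k => Λ ⊔ Submodule.span ℚ (u '' {j : Fin n | (j : ℕ) < k})
    with hWdef
  have hfgH : IsFG Λ H := (isFG_sup_left.2 (isFG_span_of_finite Λ (finite_range u))).mono hHW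
  have hfgW : ∀ k, IsFG Λ (W k) := fun k => isFG_prefix Λ u _
  have hWsδ : ∀ k, k ≤ n → IsStrong (W k) ∧ predim Λ (W k) = 0 := fun k hk =>
    chainPrefix_isStrong_and_predim_eq_zero hΛ u hu k hk
  suffices key : ∀ k, k ≤ n → H ⊓ W k ≤ U by
    have hWn : W n = Λ ⊔ Submodule.span ℚ (range u) := by
      simp only [hWdef]; rw [image_lt_of_le u le_rfl]
    intro h hh
    exact key n le_rfl (Submodule.mem_inf.2 ⟨hh, hWn ▸ hHW hh⟩)
  intro k hk
  induction k with
  | zero =>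
    intro h hh
    have hW0 : W 0 = Λ := by simp only [hWdef]; rw [image_lt_zero, Submodule.span_empty, sup_bot_eq]
    exact hΛU (hW0 ▸ (Submodule.mem_inf.1 hh).2)
  | succ k ih =>
    have ih' := ih (Nat.le_of_succ_le hk)
    have hkn : k < n := hk
    set i : Fin n := ⟨k, hkn⟩ with hi
    have hWsucc : W (k + 1) = W k ⊔ Submodule.span ℚ {u i} := by
      simp only [hWdef]; exact prefix_succ_eq Λ u hkn
    obtain ⟨hWks, hWkδ⟩ := hWsδ k (Nat.le_of_succ_le hk)
    obtain ⟨-, hWk1δ⟩ := hWsδ (k + 1) hk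
    have hWmono : W k ≤ W (k + 1) := by rw [hWsucc]; exact le_sup_left
    intro h hh
    obtain ⟨hhH, hhW⟩ := Submodule.mem_inf.1 hh
    by_cases hhWk : h ∈ W k
    · exact ih' (Submodule.mem_inf.2 ⟨hhH, hhWk⟩)
    -- the `δ = 0` spaces `V₀ = H ∩ W k ≤ V = H ∩ W (k+1)`
    set V : Submodule ℚ F := H ⊓ W (k + 1) with hVdef
    set V₀ : Submodule ℚ F := H ⊓ W k with hV₀def
    have hΛV₀ : Λ ≤ V₀ := le_inf hΛH le_sup_left
    have hV₀V : V₀ ≤ V := inf_le_inf_left H hWmono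
    have hδV : predim Λ V = 0 := predim_inf_eq_zero hΛ hΛH le_sup_left hfgH (hfgW _) hδH hWk1δ
    have hδV₀ : predim Λ V₀ = 0 := predim_inf_eq_zero hΛ hΛH le_sup_left hfgH (hfgW _) hδH hWkδ
    have hfgV : IsFG Λ V := hfgH.mono inf_le_left
    have hV₀s : IsStrong V₀ := hΛ.of_predim_eq_zero hΛV₀ (hfgH.mono inf_le_left) hδV₀
    have hfgV₀V : IsFG V₀ V := hfgV.of_le_left hΛV₀
    -- `dim V/V₀ ≤ 1`
    have hinf : V ⊓ W k = V₀ := by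
      simp only [hVdef, hV₀def]
      rw [inf_assoc, inf_eq_right.2 hWmono]
    have hldim1 : ldim V₀ V ≤ 1 := by
      rw [← hinf, ← ldim_eq_ldim_inf V (W k)]
      have hfgWW : IsFG (W k) (W (k + 1)) := (hfgW (k + 1)).of_le_left (le_sup_left : Λ ≤ W k)
      calc ldim (W k) V ≤ ldim (W k) (W (k + 1)) := ldim_mono hfgWW inf_le_right
        _ = ldim (W k) (Submodule.span ℚ {u i}) := by rw [hWsucc, ldim_sup_left]
        _ ≤ 1 := ldim_span_singleton_le _ _
    -- `V = V₀ + ℚh`, so `δ(h/V₀) = 0`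
    have hhV : h ∈ V := hh
    have hhV₀ : h ∉ V₀ := fun h' => hhWk (Submodule.mem_inf.1 h').2
    have hZ : V₀ ⊔ Submodule.span ℚ {h} ≤ V :=
      sup_le hV₀V ((Submodule.span_singleton_le_iff_mem _ _).2 hhV)
    have hVZ : V ≤ V₀ ⊔ Submodule.span ℚ {h} := by
      have hadd := ldim_add (le_sup_left : V₀ ≤ V₀ ⊔ Submodule.span ℚ {h}) hZ hfgV₀V
      rw [ldim_sup_left, ldim_span_singleton_of_not_mem hhV₀] at hadd
      have h0 : ldim (V₀ ⊔ Submodule.span ℚ {h}) V = 0 := by omega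
      exact (ldim_eq_zero_iff (hfgV₀V.of_le_left le_sup_left)).1 h0
    have hδh : predim V₀ (Submodule.span ℚ {h}) = 0 := by
      have hVeq : V = V₀ ⊔ Submodule.span ℚ {h} := le_antisymm hVZ hZ
      have hadd := predim_add hΛV₀ hV₀V hfgV
      rw [hδV, hδV₀, hVeq, predim_sup_left] at hadd
      linarith
    have htd : td V₀ (Submodule.span ℚ {h}) ≤ 1 := td_le_one_of_predim_eq_zero hhV₀ hδh
    -- `h = w + q • u i`
    have hhW1 : h ∈ W k ⊔ Submodule.span ℚ {u i} := hWsucc ▸ hhW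
    obtain ⟨w, hw, z, hz, hwz⟩ := Submodule.mem_sup.1 hhW1
    obtain ⟨q, rfl⟩ := Submodule.mem_span_singleton.1 hz
    have hgensV₀ : gens V₀ ⊆ gens (W k) := gens_mono inf_le_right
    have hV₀U : V₀ ≤ U := ih'
    have hpre : Λ ⊔ Submodule.span ℚ (u '' Set.Iio i) = W k := rfl
    rcases hu i with hA | hL
    · -- A-step: `h` is algebraic over `ℚ(gens (W k))`
      rw [hpre] at hA
      have hhacl : h ∈ acl (gens (W k)) := by
        rw [← hwz]
        exact add_mem_acl (subset_acl _ (mem_gens_of_mem hw)) (smul_mem_acl q hA)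
      have hexp : exp h ∉ acl (insert h (gens (W k))) := exp_not_mem_acl_of_mem_acl hWks hhacl hhWk
      have hexp' : exp h ∉ acl (insert h (gens V₀)) := fun h' =>
        hexp (acl_mono (insert_subset_insert hgensV₀) h')
      have hmem : h ∈ acl (gens V₀) := mem_acl_of_td_le_one htd hexp'
      exact hclosed h hhH (Or.inl (acl_mono (gens_mono hV₀U) hmem))
    · -- L-step: `exp h` is algebraic over `ℚ(gens (W k))`
      rw [hpre] at hL
      have hexph : exp h ∈ acl (gens (W k)) := by
        rw [← hwz, exp_add]
        exact mul_mem_acl (subset_acl _ (exp_mem_gens hw)) (exp_smul_mem_acl q hL)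
      have hnot : h ∉ acl (insert (exp h) (gens (W k))) :=
        not_mem_acl_of_exp_mem_acl hWks hexph hhWk
      have hnot' : h ∉ acl (insert (exp h) (gens V₀)) := fun h' =>
        hnot (acl_mono (insert_subset_insert hgensV₀) h')
      have hmem : exp h ∈ acl (gens V₀) := exp_mem_acl_of_td_le_one htd hnot'
      exact hclosed h hhH (Or.inr (acl_mono (gens_mono hV₀U) hmem))

/-- **A proper A-closed subspace of a `δ = 0` subspace of a chain space admits an L-step.** With
`Λ, u, H` as in `le_of_closed_of_le_chainSpace`: if `Λ ≤ X ≤ H`, `X ≠ H`, and `X` is A-closed in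
`H` (`h ∈ H` algebraic over `ℚ(gens X)` `⟹ h ∈ X`), there is `ℓ ∈ H ∖ X` with `exp ℓ` algebraic over
`ℚ(gens X)` and `ℓ` not. [cite: BaysKirby2018ANT, Lemma 4.8, §4.4] -/
theorem exists_Lstep_of_Aclosed {Λ H X : Submodule ℚ F} (hΛ : IsStrong Λ) {n : ℕ}
    (u : Fin n → F)
    (hu : ∀ i : Fin n, u i ∈ acl (gens (Λ ⊔ Submodule.span ℚ (u '' Set.Iio i))) ∨
      exp (u i) ∈ acl (gens (Λ ⊔ Submodule.span ℚ (u '' Set.Iio i))))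
    (hΛH : Λ ≤ H) (hHW : H ≤ Λ ⊔ Submodule.span ℚ (range u)) (hδH : predim Λ H = 0)
    (hΛX : Λ ≤ X) (hXH : X ≤ H) (hne : X ≠ H)
    (hA : ∀ h ∈ H, h ∈ acl (gens X) → h ∈ X) :
    ∃ ℓ ∈ H, ℓ ∉ X ∧ exp ℓ ∈ acl (gens X) ∧ ℓ ∉ acl (gens X) := by
  by_contra hcon
  push Not at hcon
  refine hne (le_antisymm hXH (le_of_closed_of_le_chainSpace hΛ u hu hΛH hHW hδH hΛX ?_))
  intro h hh hAL
  rcases hAL with h1 | h2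
  · exact hA h hh h1
  · by_contra hX
    exact hX (hA h hh (hcon h hh hX h2))

end CaseIIReduce

/-! ### Registered helper (crux stub list of stmt-Schanuel-0968) -/

/-- **Registered form of `CaseIIReduce.exists_Lstep_of_Aclosed`** (all binders explicit): a proper
A-closed subspace `X` of a `δ = 0` subspace `H` of an E/L/A-chain space over a strong `Λ` admits an
L-step inside `H`. [cite: BaysKirby2018ANT, Lemma 4.8, §4.4] -/
theorem caseII_reduce_exists_Lstep_of_Aclosed {F : Type} [Field F] [CharZero F] [ExponentialRing F]
    {Λ H X : Submodule ℚ F} (hΛ : IsStrong Λ) {n : ℕ} (u : Fin n → F)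
    (hu : ∀ i : Fin n, u i ∈ acl (gens (Λ ⊔ Submodule.span ℚ (u '' Set.Iio i))) ∨
      exp (u i) ∈ acl (gens (Λ ⊔ Submodule.span ℚ (u '' Set.Iio i))))
    (hΛH : Λ ≤ H) (hHW : H ≤ Λ ⊔ Submodule.span ℚ (range u)) (hδH : predim Λ H = 0)
    (hΛX : Λ ≤ X) (hXH : X ≤ H) (hne : X ≠ H)
    (hA : ∀ h ∈ H, h ∈ acl (gens X) → h ∈ X) :
    ∃ ℓ ∈ H, ℓ ∉ X ∧ exp ℓ ∈ acl (gens X) ∧ ℓ ∉ acl (gens X) :=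
  CaseIIReduce.exists_Lstep_of_Aclosed hΛ u hu hΛH hHW hδH hΛX hXH hne hA

end Summit.Schanuel.Schanuel.Theorems.RigidCore
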